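import Mathlib.GroupTheory.PresentedGroup
import Mathlib.GroupTheory.Nilpotent
import Mathlib.Logic.Equiv.Fin.Rotate
import Literature.Topology.FourManifolds.GroupTrisections
import HarnessLib

/-!
# Johnson generators II: automorphisms of the presented surface group from substitutions
(helper for stub `stub_johnsonGenerators`)

Line `saturated-torsor-descent`, crux `CongruenceShadows.NilpotentShadowsStandard`
(item stmt-SmoothPoincare4-14594).  `S_g = ⟨aⱼ, bⱼ ∣ ∏ [aⱼ, bⱼ]⟩` is the tree's PRESENTED
`SurfaceGroup g` (letters `Fin g × Bool`, `(j,false) = aⱼ`, `(j,true) = bⱼ`).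
* `exists_aut_of_subst`: a substitution killing the relators modulo the relators, with an
  inverse substitution, is an automorphism of `⟨α ∣ rels⟩` (as a TERM, no definitions); the
  registered helper `helper_johnsonSubstAut` is the surface case (relator moved to a conjugate).
* Relator bookkeeping: factorwise and blockwise (handles `0, 1` of `S_{n+3}`) substitutions fix
  `∏ [aⱼ, bⱼ]`; the rotation `j ↦ j + 1` conjugates it.
* Three symmetries of `S_{n+3}` / `S_g` with their actions on letters: the handle rotation, the
  swap of handles `0, 1` (`x₀ ↦ c₀ x₁ c₀⁻¹`, `x₁ ↦ x₀`), the in-handle flip (`aⱼ ↦ aⱼbⱼaⱼ⁻¹`,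
  `bⱼ ↦ aⱼ⁻¹`).
No definitions.
-/

set_option linter.dupNamespace false

open Subgroup Literature.Topology.FourManifolds
open scoped commutatorElement

namespace Summit.SmoothPoincare4.SmoothPoincare4.Theorems.NilpotentShadowsStandard.SaturatedTorsorDescent

/-! ## Automorphisms of presented groups from substitutions -/

section Subst

variable {α : Type*} {rels : Set (FreeGroup α)}

/-- **An automorphism of `⟨α ∣ rels⟩` from a substitution `φ` killing the relators modulo the
relators and an inverse substitution `φ'`** (inverse modulo the relators, checked on generators),
with its action and that of its inverse on words. [folklore] -/
theorem exists_aut_of_subst (φ φ' : α → FreeGroup α)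
    (hφ : ∀ r ∈ rels, (PresentedGroup.mk rels (FreeGroup.lift φ r) : PresentedGroup rels) = 1)
    (hφ' : ∀ r ∈ rels, (PresentedGroup.mk rels (FreeGroup.lift φ' r) : PresentedGroup rels) = 1)
    (h₁ : ∀ x, (PresentedGroup.mk rels (FreeGroup.lift φ' (φ x)) : PresentedGroup rels) =
      PresentedGroup.of x)
    (h₂ : ∀ x, (PresentedGroup.mk rels (FreeGroup.lift φ (φ' x)) : PresentedGroup rels) =
      PresentedGroup.of x) :
    ∃ ψ : PresentedGroup rels ≃* PresentedGroup rels,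
      (∀ w, ψ (PresentedGroup.mk rels w) = PresentedGroup.mk rels (FreeGroup.lift φ w)) ∧
      (∀ w, ψ.symm (PresentedGroup.mk rels w) = PresentedGroup.mk rels (FreeGroup.lift φ' w)) := by
  have key : ∀ θ : α → FreeGroup α,
      (∀ r ∈ rels, (PresentedGroup.mk rels (FreeGroup.lift θ r) : PresentedGroup rels) = 1) →
      ∀ r ∈ rels, ((PresentedGroup.mk rels).comp (FreeGroup.lift θ)) r = 1 :=
    fun θ hθ r hr => by simpa using hθ r hr
  refine ⟨MonoidHom.toMulEquiv
    (presentedLift ((PresentedGroup.mk rels).comp (FreeGroup.lift φ)) (key φ hφ))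
    (presentedLift ((PresentedGroup.mk rels).comp (FreeGroup.lift φ')) (key φ' hφ'))
    (PresentedGroup.ext fun x => ?_) (PresentedGroup.ext fun x => ?_), fun w => ?_, fun w => ?_⟩
  · simp only [MonoidHom.comp_apply, MonoidHom.id_apply, PresentedGroup.of, presentedLift_mk,
      FreeGroup.lift_apply_of]
    rw [← PresentedGroup.of, ← h₁ x]
  · simp only [MonoidHom.comp_apply, MonoidHom.id_apply, PresentedGroup.of, presentedLift_mk,
      FreeGroup.lift_apply_of]
    rw [← PresentedGroup.of, ← h₂ x]
  · simp
  · simp [MonoidHom.toMulEquiv]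

end Subst

/-! ## The surface relator under substitutions -/

section Relator

variable {g : ℕ}

/-- A substitution moving `∏ [aⱼ, bⱼ]` to a conjugate kills it modulo the relator. [folklore] -/
theorem mk_surfaceRelator_of_conj {φ : Fin g × Bool → FreeGroup (Fin g × Bool)}
    (h : FreeGroup (Fin g × Bool))
    (hφ : FreeGroup.lift φ (surfaceRelator g) = h * surfaceRelator g * h⁻¹) :
    ∀ r ∈ ({surfaceRelator g} : Set (FreeGroup (Fin g × Bool))),
      (PresentedGroup.mk {surfaceRelator g} (FreeGroup.lift φ r) : SurfaceGroup g) = 1 := by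
  intro r hr
  rw [Set.mem_singleton_iff] at hr
  subst hr
  rw [hφ, map_mul, map_mul, PresentedGroup.one_of_mem (Set.mem_singleton _), mul_one, map_inv,
    mul_inv_cancel]

/-- A substitution fixing `∏ [aⱼ, bⱼ]` kills it modulo the relator. [folklore] -/
theorem mk_surfaceRelator_of_eq {φ : Fin g × Bool → FreeGroup (Fin g × Bool)}
    (hφ : FreeGroup.lift φ (surfaceRelator g) = surfaceRelator g) :
    ∀ r ∈ ({surfaceRelator g} : Set (FreeGroup (Fin g × Bool))),
      (PresentedGroup.mk {surfaceRelator g} (FreeGroup.lift φ r) : SurfaceGroup g) = 1 :=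
  mk_surfaceRelator_of_conj 1 (by rw [hφ, one_mul, inv_one, mul_one])

/-- The relator is the ordered product of the handle commutators `⁅aⱼ, bⱼ⁆`. [folklore] -/
theorem surfaceRelator_eq_prod (g : ℕ) :
    surfaceRelator g = ((List.finRange g).map fun j => ⁅genA j, genB j⁆).prod := rfl

/-- **Factorwise substitutions fix the relator**: if `[φ aⱼ, φ bⱼ] = [aⱼ, bⱼ]` in the free group
for every handle. [folklore] -/
theorem lift_surfaceRelator_of_factorwise (φ : Fin g × Bool → FreeGroup (Fin g × Bool))
    (h : ∀ j : Fin g, FreeGroup.lift φ ⁅genA j, genB j⁆ = ⁅genA j, genB j⁆) :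
    FreeGroup.lift φ (surfaceRelator g) = surfaceRelator g := by
  rw [surfaceRelator_eq_prod, map_list_prod, List.map_map]
  exact congrArg _ (List.map_congr_left fun j _ => h j)

/-- Splitting off the first three handles of a product over `Fin (n + 3)`. [folklore] -/
theorem prod_finRange_add_three {M : Type*} [Monoid M] (n : ℕ) (f : Fin (n + 3) → M) :
    ((List.finRange (n + 3)).map f).prod =
      f 0 * (f 1 * (f 2 * ((List.finRange n).map fun j => f j.succ.succ.succ).prod)) := by
  rw [List.finRange_succ, List.finRange_succ, List.finRange_succ]
  simp [List.map_cons, List.prod_cons, List.map_map, Function.comp_def]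

/-- `(2 : Fin (n+3)) ≠ 0`. [folklore] -/
theorem fin_two_ne_zero (n : ℕ) : (2 : Fin (n + 3)) ≠ 0 := by
  simp [Fin.ext_iff, Nat.mod_eq_of_lt (show 2 < n + 3 by omega)]

/-- `(2 : Fin (n+3)) ≠ 1`. [folklore] -/
theorem fin_two_ne_one (n : ℕ) : (2 : Fin (n + 3)) ≠ 1 := by
  simp [Fin.ext_iff, Nat.mod_eq_of_lt (show 2 < n + 3 by omega), Nat.mod_eq_of_lt (show 1 < n + 3 by omega)]

/-- `(1 : Fin (n+3)) ≠ 0`. [folklore] -/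
theorem fin_one_ne_zero (n : ℕ) : (1 : Fin (n + 3)) ≠ 0 := by simp

/-- Handles `j + 3` are not handle `0`. [folklore] -/
theorem fin_succ3_ne_zero {n : ℕ} (j : Fin n) : (j.succ.succ.succ : Fin (n + 3)) ≠ 0 :=
  Fin.succ_ne_zero _

/-- Handles `j + 3` are not handle `1`. [folklore] -/
theorem fin_succ3_ne_one {n : ℕ} (j : Fin n) : (j.succ.succ.succ : Fin (n + 3)) ≠ 1 := by
  simp only [ne_eq, Fin.ext_iff, Fin.val_succ, Fin.val_one', Nat.mod_eq_of_lt (show 1 < n + 3 by omega)]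
  omega

/-- Handles `j + 3` are not handle `2`. [folklore] -/
theorem fin_succ3_ne_two {n : ℕ} (j : Fin n) : (j.succ.succ.succ : Fin (n + 3)) ≠ 2 := by
  simp only [ne_eq, Fin.ext_iff, Fin.val_succ, Fin.val_two]
  omega

/-- **Blockwise substitutions on handles `0, 1` fix the relator**: `φ(c₀) φ(c₁) = c₀ c₁` and the
letters of all other handles fixed. [folklore] -/
theorem lift_surfaceRelator_of_block {n : ℕ} (φ : Fin (n + 3) × Bool → FreeGroup (Fin (n + 3) × Bool))
    (hblock : FreeGroup.lift φ ⁅genA (0 : Fin (n + 3)), genB 0⁆ * FreeGroup.lift φ ⁅genA (1 : Fin (n + 3)), genB 1⁆ =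
      ⁅genA (0 : Fin (n + 3)), genB 0⁆ * ⁅genA (1 : Fin (n + 3)), genB 1⁆)
    (hrest : ∀ (j : Fin (n + 3)) (ε : Bool), j ≠ 0 → j ≠ 1 → φ (j, ε) = FreeGroup.of (j, ε)) :
    FreeGroup.lift φ (surfaceRelator (n + 3)) = surfaceRelator (n + 3) := by
  have hc : ∀ j : Fin (n + 3), j ≠ 0 → j ≠ 1 → FreeGroup.lift φ ⁅genA j, genB j⁆ = ⁅genA j, genB j⁆ :=
    fun j h0 h1 => by simp [genA, genB, hrest j _ h0 h1]
  rw [surfaceRelator_eq_prod, map_list_prod, List.map_map, prod_finRange_add_three,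
    prod_finRange_add_three]
  have htail : ((List.finRange n).map fun j => (⇑(FreeGroup.lift φ) ∘ fun j => ⁅genA j, genB j⁆) j.succ.succ.succ) =
      (List.finRange n).map fun j => ⁅genA j.succ.succ.succ, genB j.succ.succ.succ⁆ :=
    List.map_congr_left fun j _ => hc _ (fin_succ3_ne_zero j) (fin_succ3_ne_one j)
  rw [htail, Function.comp_apply, Function.comp_apply, Function.comp_apply,
    hc 2 (fin_two_ne_zero n) (fin_two_ne_one n), ← mul_assoc, hblock, mul_assoc]

/-- **Rotation conjugates the relator**: `ρ(∏ⱼ cⱼ) = c₁ ⋯ c_{n+2} c₀ = c₀⁻¹ (∏ⱼ cⱼ) c₀`. [folklore] -/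
theorem lift_rot_surfaceRelator (n : ℕ) :
    FreeGroup.lift (fun x : Fin (n + 3) × Bool => FreeGroup.of (finRotate (n + 3) x.1, x.2))
        (surfaceRelator (n + 3)) =
      (⁅genA (0 : Fin (n + 3)), genB 0⁆)⁻¹ * surfaceRelator (n + 3) * ⁅genA (0 : Fin (n + 3)), genB 0⁆ := by
  rw [surfaceRelator_eq_prod, map_list_prod, List.map_map]
  have hf : (⇑(FreeGroup.lift fun x : Fin (n + 3) × Bool => FreeGroup.of (finRotate (n + 3) x.1, x.2)) ∘
      fun j => ⁅genA j, genB j⁆) = fun j => ⁅genA (finRotate (n + 3) j), genB (finRotate (n + 3) j)⁆ :=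
    funext fun j => by simp [genA, genB]
  have hrot : ∀ i : Fin (n + 2), finRotate (n + 3) (Fin.castSucc i) = i.succ := fun i =>
    finRotate_of_lt i.is_lt
  rw [hf]
  conv_lhs => rw [List.finRange_succ_last]
  conv_rhs => rw [List.finRange_succ]
  simp only [List.map_append, List.map_map, List.map_cons, List.map_nil, List.prod_append,
    List.prod_cons, List.prod_nil, Function.comp_def, finRotate_last, mul_one, hrot]
  group

/-- **Inverse rotation conjugates the relator**: `ρ⁻¹(∏ⱼ cⱼ) = c_last (∏ⱼ cⱼ) c_last⁻¹`. [folklore] -/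
theorem lift_rotInv_surfaceRelator (n : ℕ) :
    FreeGroup.lift (fun x : Fin (n + 3) × Bool => FreeGroup.of ((finRotate (n + 3)).symm x.1, x.2))
        (surfaceRelator (n + 3)) =
      ⁅genA (Fin.last (n + 2)), genB (Fin.last (n + 2))⁆ * surfaceRelator (n + 3) *
        (⁅genA (Fin.last (n + 2)), genB (Fin.last (n + 2))⁆)⁻¹ := by
  rw [surfaceRelator_eq_prod, map_list_prod, List.map_map]
  have h1 : ∀ i : Fin (n + 2), (finRotate (n + 3)).symm i.succ = Fin.castSucc i := fun i => by
    rw [Equiv.symm_apply_eq]; exact (finRotate_of_lt i.is_lt).symm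
  have h0 : (finRotate (n + 3)).symm 0 = Fin.last (n + 2) := by
    rw [Equiv.symm_apply_eq]; exact finRotate_last.symm
  have hf : (⇑(FreeGroup.lift fun x : Fin (n + 3) × Bool =>
      FreeGroup.of ((finRotate (n + 3)).symm x.1, x.2)) ∘ fun j => ⁅genA j, genB j⁆) =
      fun j => ⁅genA ((finRotate (n + 3)).symm j), genB ((finRotate (n + 3)).symm j)⁆ :=
    funext fun j => by simp [genA, genB]
  rw [hf]
  conv_lhs => rw [List.finRange_succ]
  conv_rhs => rw [List.finRange_succ_last]
  simp only [List.map_append, List.map_map, List.map_cons, List.map_nil, List.prod_append,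
    List.prod_cons, List.prod_nil, Function.comp_def, h1, h0, mul_one]
  group

end Relator

/-! ## Symmetries of the presented surface group: rotation, adjacent swap, in-handle flip -/

section Symmetries

/-- **The handle rotation** `aⱼ ↦ aⱼ₊₁`, `bⱼ ↦ bⱼ₊₁` (indices mod `n + 3`) is an automorphism of
the presented `S_{n+3}` (it moves the relator to a conjugate). [folklore] -/
theorem exists_rotAut (n : ℕ) : ∃ ρ : SurfaceGroup (n + 3) ≃* SurfaceGroup (n + 3),
    ∀ x : Fin (n + 3) × Bool,
      ρ (PresentedGroup.of x) = (PresentedGroup.of (x.1 + 1, x.2) : SurfaceGroup (n + 3)) := by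
  obtain ⟨ρ, hρ, -⟩ := exists_aut_of_subst (rels := {surfaceRelator (n + 3)})
    (fun x : Fin (n + 3) × Bool => FreeGroup.of (finRotate (n + 3) x.1, x.2))
    (fun x : Fin (n + 3) × Bool => FreeGroup.of ((finRotate (n + 3)).symm x.1, x.2))
    (mk_surfaceRelator_of_conj (⁅genA (0 : Fin (n + 3)), genB 0⁆)⁻¹ (by rw [lift_rot_surfaceRelator, inv_inv]))
    (mk_surfaceRelator_of_conj _ (lift_rotInv_surfaceRelator n))
    (fun x => by simp [PresentedGroup.of]) (fun x => by simp [PresentedGroup.of])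
  exact ⟨ρ, fun x => by rw [PresentedGroup.of, hρ, FreeGroup.lift_apply_of, finRotate_apply,
    PresentedGroup.of]⟩

/-- **The swap of handles `0` and `1`**: `x₀ ↦ c₀ x₁ c₀⁻¹`, `x₁ ↦ x₀` (`c₀ = [a₀, b₀]`, `x = a, b`),
fixing the relator on the nose (`φ(c₀) φ(c₁) = c₀ c₁ c₀⁻¹ · c₀`), as an automorphism of the
presented `S_{n+3}`. [folklore] -/
theorem exists_swapAut (n : ℕ) : ∃ φ : SurfaceGroup (n + 3) ≃* SurfaceGroup (n + 3),
    (∀ ε : Bool, φ (PresentedGroup.of (0, ε)) =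
      ⁅(PresentedGroup.of (0, false) : SurfaceGroup (n + 3)), PresentedGroup.of (0, true)⁆ *
        PresentedGroup.of (1, ε) *
        (⁅(PresentedGroup.of (0, false) : SurfaceGroup (n + 3)), PresentedGroup.of (0, true)⁆)⁻¹) ∧
    (∀ ε : Bool, φ (PresentedGroup.of (1, ε)) = PresentedGroup.of (0, ε)) ∧
    (∀ (j : Fin (n + 3)) (ε : Bool), j ≠ 0 → j ≠ 1 →
      φ (PresentedGroup.of (j, ε)) = PresentedGroup.of (j, ε)) := by
  have h10 := fin_one_ne_zero n
  obtain ⟨φ, hφ, -⟩ := exists_aut_of_subst (rels := {surfaceRelator (n + 3)})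
    (fun x : Fin (n + 3) × Bool => if x.1 = 0 then ⁅genA (0 : Fin (n + 3)), genB 0⁆ * FreeGroup.of (1, x.2) * (⁅genA (0 : Fin (n + 3)), genB 0⁆)⁻¹
      else if x.1 = 1 then FreeGroup.of (0, x.2) else FreeGroup.of x)
    (fun x : Fin (n + 3) × Bool => if x.1 = 0 then FreeGroup.of (1, x.2)
      else if x.1 = 1 then (⁅genA (1 : Fin (n + 3)), genB 1⁆)⁻¹ * FreeGroup.of (0, x.2) * ⁅genA (1 : Fin (n + 3)), genB 1⁆ else FreeGroup.of x)
    (mk_surfaceRelator_of_eq (lift_surfaceRelator_of_block _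
      (by simp only [genA, genB, commutatorElement_def, map_mul, map_inv, FreeGroup.lift_apply_of, if_true, if_false, h10]; group)
      (fun j ε h0 h1 => by simp [h0, h1])))
    (mk_surfaceRelator_of_eq (lift_surfaceRelator_of_block _
      (by simp only [genA, genB, commutatorElement_def, map_mul, map_inv, FreeGroup.lift_apply_of, if_true, if_false, h10]; group)
      (fun j ε h0 h1 => by simp [h0, h1])))
    (fun x => by
      obtain ⟨j, ε⟩ := x
      by_cases h0 : j = 0
      · subst h0
        simp only [genA, genB, if_true, if_false, h10, commutatorElement_def, map_mul, map_inv,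
          FreeGroup.lift_apply_of, PresentedGroup.of]
        group
      by_cases h1 : j = 1
      · subst h1
        simp only [genA, genB, if_true, if_false, h10, commutatorElement_def,
          FreeGroup.lift_apply_of, PresentedGroup.of]
      simp [h0, h1, PresentedGroup.of])
    (fun x => by
      obtain ⟨j, ε⟩ := x
      by_cases h0 : j = 0
      · subst h0
        simp only [genA, genB, if_true, if_false, h10, commutatorElement_def,
          FreeGroup.lift_apply_of, PresentedGroup.of]
      by_cases h1 : j = 1
      · subst h1
        simp only [genA, genB, if_true, if_false, h10, commutatorElement_def, map_mul, map_inv,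
          FreeGroup.lift_apply_of, PresentedGroup.of]
        group
      simp [h0, h1, PresentedGroup.of])
  refine ⟨φ, fun ε => ?_, fun ε => ?_, fun j ε h0 h1 => ?_⟩
  · rw [PresentedGroup.of, hφ]
    simp [genA, genB, PresentedGroup.of, commutatorElement_def, mul_assoc]
  · rw [PresentedGroup.of, hφ]
    simp [h10, PresentedGroup.of]
  · rw [PresentedGroup.of, hφ]
    simp [h0, h1]

/-- **The in-handle flip** `aⱼ ↦ aⱼ bⱼ aⱼ⁻¹`, `bⱼ ↦ aⱼ⁻¹` (factorwise: `[aⱼ bⱼ aⱼ⁻¹, aⱼ⁻¹] = [aⱼ, bⱼ]`;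
on homology the rotation `a ↦ b ↦ -a` of handle `j`) as an automorphism of the presented `S_g`.
[folklore] -/
theorem exists_flipAut {g : ℕ} (j : Fin g) : ∃ φ : SurfaceGroup g ≃* SurfaceGroup g,
    φ (PresentedGroup.of (j, false)) =
      (PresentedGroup.of (j, false) : SurfaceGroup g) * PresentedGroup.of (j, true) *
        (PresentedGroup.of (j, false) : SurfaceGroup g)⁻¹ ∧
    φ (PresentedGroup.of (j, true)) = (PresentedGroup.of (j, false) : SurfaceGroup g)⁻¹ ∧
    (∀ (k : Fin g) (ε : Bool), k ≠ j → φ (PresentedGroup.of (k, ε)) = PresentedGroup.of (k, ε)) := by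
  obtain ⟨φ, hφ, -⟩ := exists_aut_of_subst (rels := {surfaceRelator g})
    (fun x : Fin g × Bool => if x.1 = j then (if x.2 then (genA j)⁻¹ else genA j * genB j * (genA j)⁻¹)
      else FreeGroup.of x)
    (fun x : Fin g × Bool => if x.1 = j then (if x.2 then genB j * genA j * (genB j)⁻¹ else (genB j)⁻¹)
      else FreeGroup.of x)
    (mk_surfaceRelator_of_eq (lift_surfaceRelator_of_factorwise _ fun k => by
      by_cases hk : k = j
      · subst hk; simp only [genA, genB, commutatorElement_def, map_mul, map_inv, FreeGroup.lift_apply_of, if_true,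
          Bool.false_eq_true, if_false]; group
      · simp [genA, genB, hk]))
    (mk_surfaceRelator_of_eq (lift_surfaceRelator_of_factorwise _ fun k => by
      by_cases hk : k = j
      · subst hk; simp only [genA, genB, commutatorElement_def, map_mul, map_inv, FreeGroup.lift_apply_of, if_true,
          Bool.false_eq_true, if_false]; group
      · simp [genA, genB, hk]))
    (fun x => by
      obtain ⟨k, ε⟩ := x
      by_cases hk : k = j
      · subst hk
        cases ε <;> simp only [genA, genB, if_true, Bool.false_eq_true, if_false, map_mul, map_inv,
          FreeGroup.lift_apply_of, PresentedGroup.of] <;> group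
      · simp [hk, PresentedGroup.of])
    (fun x => by
      obtain ⟨k, ε⟩ := x
      by_cases hk : k = j
      · subst hk
        cases ε <;> simp only [genA, genB, if_true, Bool.false_eq_true, if_false, map_mul, map_inv,
          FreeGroup.lift_apply_of, PresentedGroup.of] <;> group
      · simp [hk, PresentedGroup.of])
  refine ⟨φ, ?_, ?_, fun k ε hk => ?_⟩
  · rw [PresentedGroup.of, hφ]; simp [genA, genB, PresentedGroup.of]
  · rw [PresentedGroup.of, hφ]; simp [genA, PresentedGroup.of]
  · rw [PresentedGroup.of, hφ]; simp [hk]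

end Symmetries

/-- **Registered helper**: a letter substitution moving `∏ [aⱼ, bⱼ]` to a conjugate, with an inverse substitution (checked on letters), induces an automorphism of the presented `S_g` with the given action on words. [folklore] -/
theorem helper_johnsonSubstAut : ∀ (g : ℕ) (φ φ' : Fin g × Bool → FreeGroup (Fin g × Bool)) (h h' : FreeGroup (Fin g × Bool)), FreeGroup.lift φ (Literature.Topology.FourManifolds.surfaceRelator g) = h * Literature.Topology.FourManifolds.surfaceRelator g * h⁻¹ → FreeGroup.lift φ' (Literature.Topology.FourManifolds.surfaceRelator g) = h' * Literature.Topology.FourManifolds.surfaceRelator g * h'⁻¹ → (∀ x : Fin g × Bool, (PresentedGroup.mk {Literature.Topology.FourManifolds.surfaceRelator g} (FreeGroup.lift φ' (φ x)) : Literature.Topology.FourManifolds.SurfaceGroup g) = PresentedGroup.of x) → (∀ x : Fin g × Bool, (PresentedGroup.mk {Literature.Topology.FourManifolds.surfaceRelator g} (FreeGroup.lift φ (φ' x)) : Literature.Topology.FourManifolds.SurfaceGroup g) = PresentedGroup.of x) → ∃ ψ : Literature.Topology.FourManifolds.SurfaceGroup g ≃* Literature.Topology.FourManifolds.SurfaceGroup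 g, (∀ w : FreeGroup (Fin g × Bool), ψ (PresentedGroup.mk {Literature.Topology.FourManifolds.surfaceRelator g} w) = PresentedGroup.mk {Literature.Topology.FourManifolds.surfaceRelator g} (FreeGroup.lift φ w)) ∧ (∀ w : FreeGroup (Fin g × Bool), ψ.symm (PresentedGroup.mk {Literature.Topology.FourManifolds.surfaceRelator g} w) = PresentedGroup.mk {Literature.Topology.FourManifolds.surfaceRelator g} (FreeGroup.lift φ' w)) := by
  intro g φ φ' h h' hφ hφ' h₁ h₂
  exact exists_aut_of_subst φ φ' (mk_surfaceRelator_of_conj h hφ) (mk_surfaceRelator_of_conj h' hφ') h₁ h₂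

end Summit.SmoothPoincare4.SmoothPoincare4.Theorems.NilpotentShadowsStandard.SaturatedTorsorDescent
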